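import Summits.Ventures.CertifiedManyBodySolver.Downfold.EmerySecularFormDefectAxial
import HarnessLib

/-!
# The one-band form defect of the bilinear secular family, IV: TWO Cu-site a₁ channels (one ABOVE, one BELOW the Fermi level) —
# the same one-coordinate law with ADDITIVE slopes, and the sign structure (shape co-shifts signed, slopes always positive)

Venture CertifiedManyBodySolver, cell `pub/hubbard-downfold` (stage S1, INFL-3to1-B at the antinode), seat hubbard-downfold-mod-4 (technique B);
namespace `Summit.Ventures.CertifiedManyBodySolver.Downfold.Emery`. Everything here is PROVED (exact algebra + one chain rule). WHAT THIS IS NOT: a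
statement about any material (no number lives here); `U = 0` one-body kinematics; which a₁ channels a material has is NOT decided here.

`EmerySecularFormDefectAxial` treated ONE Cu-site a₁ orbital (the Cu-4s / apical hybrid of [PavariniEtAl2001]) with Löwdin admixture
`a(ε) = T/(ε_a − ε)`, `T = t²`, and proved: at fixed Fermi surface the four-orbital form defect is `δ = δ_σ̄ + κ·a′`, `a′ = T/(ε_a − ε_F)²`.
A cuprate Cu site carries SEVERAL a₁ orbitals coupling to the in-plane `(p_x, p_y)` pair with the same `(+, +)` form factors — Cu 4s ABOVE the
band and the Cu 3d_{3z²−r²} / apical-O p_z hybrid BELOW it ([PavariniEtAl2001]: «the axial orbital is a hybrid of Cu 4s, apical O 2p_z and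
Cu 3d_{3z²−1}»; eliminating any on-site a₁ block gives a sum of simple poles `Σ_i T_i/(ε_i − ε)`, `T_i ≥ 0`). This file does the two-pole case
exactly:

* §1 `sec5 = (ε_s − ε)(ε_z − ε)·charCubic + [T_s(ε_z − ε) + T_z(ε_s − ε)]·axialLin` — the five-orbital secular function cleared of both poles;
  it is the σ cubic CO-SHIFTED by `a_s(ε) + a_z(ε)` (`sec5_eq_coshift`): every contour is again a `t–t′` contour.
* §2 FIXED FERMI SURFACE (`sec5_fixedFS`, `dsec5_fixedFS`, `dsec5_eq_W4`): splitting the frozen O–O couplings `(t̄_pp, t̄_pp′)` as direct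
  `+ α_s + α_z` with `T_i = α_i(ε_i − ε_F)` keeps the contour and gives the energy derivative
  `(ε_s − ε_F)(ε_z − ε_F)·W4 (a′_s + a′_z)`, `a′_i = α_i/(ε_i − ε_F) = T_i/(ε_i − ε_F)²` — **the one-parameter law of part II holds with the
  slopes ADDED**: `1 + δ = (1 + δ_σ̄) + (a′_s + a′_z)·κ` (`formDefect4_linear` applies verbatim to `W4 (a′_s + a′_z)`).
* §3 SIGN STRUCTURE (`admixture_pos_of_above`, `admixture_neg_of_below`, `slope_pos`): a level ABOVE `ε_F` co-shifts the O–O couplings UP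
  (`α > 0`: more curved Fermi surface, `fsRatio_coshift_anti`), a level BELOW co-shifts them DOWN (`α < 0`: flatter Fermi surface), but BOTH have
  POSITIVE slope `a′ = T/(ε_a − ε_F)² > 0` (slower antinode). Hence (`shape_cancel_slope_add`) two channels on opposite sides can CANCEL in the
  Fermi-surface shape (`α_s + α_z = 0`) while their form-defect slopes ADD (`a′_s + a′_z = α_s·(1/(ε_s − ε_F) + 1/(ε_F − ε_z)) > 0`) — a flat,
  `t–t′`-exact Fermi surface with a large antinodal form defect is the signature of an a₁ level CLOSE BELOW the Fermi level whose shape effect is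
  compensated from above (the reading of the La₂CuO₄ rows of `router/EMERY-FORM-DEFECT.tsv`, INFLATION-RULES-3to1-B §B.66 (f)).

Sources: four-orbital model and the axial hybrid [PavariniEtAl2001, Eqs. (1)–(3) and text]; energy-dependent downfolding [AndersenEtAl1995, §6–§7];
three-band model [HybertsenSchluterChristensen1989, Eq. (1)].
-/

noncomputable section

namespace Summit.Ventures.CertifiedManyBodySolver.Downfold.Emery

open Real

/-! ## §1 Two a₁ poles -/

/-- The five-orbital (σ + two Cu-site a₁ channels) secular function cleared of its two poles:
`sec5 = (ε_s − ε)(ε_z − ε)·charCubic + [T_s(ε_z − ε) + T_z(ε_s − ε)]·axialLin`. [cite: PavariniEtAl2001, Eqs. (1)–(3)] -/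
def sec5 (Δ εs εz tpd tpp c Ts Tz x y ε : ℝ) : ℝ :=
  (εs - ε) * (εz - ε) * charCubic Δ tpd tpp c x y ε + (Ts * (εz - ε) + Tz * (εs - ε)) * axialLin Δ tpd tpp c x y ε

/-- Away from both poles `sec5` is `(ε_s − ε)(ε_z − ε)` times the σ cubic CO-SHIFTED by the SUM of the two admixtures
`a_s + a_z = T_s/(ε_s − ε) + T_z/(ε_z − ε)` — so every contour of the five-orbital model is a `t–t′` contour. [cite: PavariniEtAl2001, Eqs. (1)–(3)] -/
theorem sec5_eq_coshift (Δ εs εz tpd tpp c Ts Tz x y ε : ℝ) (hs : εs - ε ≠ 0) (hz : εz - ε ≠ 0) :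
    sec5 Δ εs εz tpd tpp c Ts Tz x y ε =
      (εs - ε) * (εz - ε) * charCubic Δ tpd (tpp + (Ts / (εs - ε) + Tz / (εz - ε))) (c + (Ts / (εs - ε) + Tz / (εz - ε))) x y ε := by
  rw [charCubic_coshift, sec5]
  field_simp

/-! ## §2 Fixed Fermi surface: the slopes add -/

/-- FIXED FERMI SURFACE, I: with `T_s = α_s(ε_s − ε)`, `T_z = α_z(ε_z − ε)` and direct couplings `(t̄_pp − α_s − α_z, t̄_pp′ − α_s − α_z)` the
five-orbital secular function at `ε` is `(ε_s − ε)(ε_z − ε)` times the frozen σ cubic — same contour, same filling, for every split.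
[cite: PavariniEtAl2001, Eqs. (1)–(3)] -/
theorem sec5_fixedFS (Δ εs εz tpd tpp c αs αz Ts Tz x y ε : ℝ) (hTs : Ts = αs * (εs - ε)) (hTz : Tz = αz * (εz - ε)) :
    sec5 Δ εs εz tpd (tpp - αs - αz) (c - αs - αz) Ts Tz x y ε = (εs - ε) * (εz - ε) * charCubic Δ tpd tpp c x y ε := by
  unfold sec5
  have h1 : charCubic Δ tpd (tpp - αs - αz) (c - αs - αz) x y ε =
      charCubic Δ tpd tpp c x y ε + (-(αs + αz)) * axialLin Δ tpd tpp c x y ε := by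
    rw [← charCubic_coshift]; ring_nf
  have h2 : axialLin Δ tpd (tpp - αs - αz) (c - αs - αz) x y ε = axialLin Δ tpd tpp c x y ε := by
    rw [← axialLin_coshift Δ tpd (tpp - αs - αz) (c - αs - αz) (αs + αz)]; ring_nf
  rw [h1, h2, hTs, hTz]; ring

/-- The energy derivative of `sec5`. [folklore] -/
def dsec5 (Δ εs εz tpd tpp c Ts Tz x y ε : ℝ) : ℝ :=
  -((εz - ε) + (εs - ε)) * charCubic Δ tpd tpp c x y ε + (εs - ε) * (εz - ε) * dcharCubic Δ tpd tpp c x y ε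
    - (Ts + Tz) * axialLin Δ tpd tpp c x y ε + (Ts * (εz - ε) + Tz * (εs - ε)) * daxialLin Δ tpp c x y ε

/-- `d sec5/dε = dsec5`. [folklore] -/
theorem hasDerivAt_sec5_eps (Δ εs εz tpd tpp c Ts Tz x y ε : ℝ) :
    HasDerivAt (fun e => sec5 Δ εs εz tpd tpp c Ts Tz x y e) (dsec5 Δ εs εz tpd tpp c Ts Tz x y ε) ε := by
  unfold sec5
  have hpre : HasDerivAt (fun e => (εs - e) * (εz - e)) (-1 * (εz - ε) + (εs - ε) * -1) ε :=
    ((hasDerivAt_id' ε).const_sub εs).mul ((hasDerivAt_id' ε).const_sub εz)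
  have h1 := hpre.mul (hasDerivAt_charCubic_eps Δ tpd tpp c x y ε)
  have hco : HasDerivAt (fun e => Ts * (εz - e) + Tz * (εs - e)) (Ts * -1 + Tz * -1) ε :=
    (((hasDerivAt_id' ε).const_sub εz).const_mul Ts).add (((hasDerivAt_id' ε).const_sub εs).const_mul Tz)
  have h2 := hco.mul (hasDerivAt_axialLin_eps Δ tpd tpp c x y ε)
  refine (h1.add h2).congr_deriv ?_
  unfold dsec5; ring

/-- FIXED FERMI SURFACE, II: ON the frozen contour the five-orbital energy derivative is
`(ε_s − ε)(ε_z − ε)·dcharCubic(t̄) + [α_s(ε_z − ε) + α_z(ε_s − ε)]·axialLin(t̄)` — the `daxialLin` terms cancel again.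
[cite: AndersenEtAl1995, §7] -/
theorem dsec5_fixedFS (Δ εs εz tpd tpp c αs αz Ts Tz x y ε : ℝ) (hTs : Ts = αs * (εs - ε)) (hTz : Tz = αz * (εz - ε))
    (hP : charCubic Δ tpd tpp c x y ε = 0) :
    dsec5 Δ εs εz tpd (tpp - αs - αz) (c - αs - αz) Ts Tz x y ε =
      (εs - ε) * (εz - ε) * dcharCubic Δ tpd tpp c x y ε + (αs * (εz - ε) + αz * (εs - ε)) * axialLin Δ tpd tpp c x y ε := by
  unfold dsec5
  have h1 : charCubic Δ tpd (tpp - αs - αz) (c - αs - αz) x y ε =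
      charCubic Δ tpd tpp c x y ε + (-(αs + αz)) * axialLin Δ tpd tpp c x y ε := by
    rw [← charCubic_coshift]; ring_nf
  have h2 : dcharCubic Δ tpd (tpp - αs - αz) (c - αs - αz) x y ε =
      dcharCubic Δ tpd tpp c x y ε + (-(αs + αz)) * daxialLin Δ tpp c x y ε := by
    rw [← dcharCubic_coshift]; ring_nf
  have h3 : axialLin Δ tpd (tpp - αs - αz) (c - αs - αz) x y ε = axialLin Δ tpd tpp c x y ε := by
    rw [← axialLin_coshift Δ tpd (tpp - αs - αz) (c - αs - αz) (αs + αz)]; ring_nf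
  have h4 : daxialLin Δ (tpp - αs - αz) (c - αs - αz) x y ε = daxialLin Δ tpp c x y ε := by
    rw [← daxialLin_coshift Δ (tpp - αs - αz) (c - αs - αz) (αs + αz)]; ring_nf
  rw [h1, h2, h3, h4, hP, hTs, hTz]; ring

/-- **THE SLOPES ADD.** On the frozen contour (`ε ≠ ε_s, ε_z`): `dsec5 = (ε_s − ε)(ε_z − ε)·W4 (α_s/(ε_s − ε) + α_z/(ε_z − ε))` — the
one-parameter law `formDefect4_linear` of part II holds for the two-channel model with admixture slope `a′ = a′_s + a′_z`,
`a′_i = α_i/(ε_i − ε) = T_i/(ε_i − ε)²`. [cite: AndersenEtAl1995, §7] -/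
theorem dsec5_eq_W4 (Δ εs εz tpd tpp c αs αz Ts Tz x y ε : ℝ) (hs : εs - ε ≠ 0) (hz : εz - ε ≠ 0)
    (hTs : Ts = αs * (εs - ε)) (hTz : Tz = αz * (εz - ε)) (hP : charCubic Δ tpd tpp c x y ε = 0) :
    dsec5 Δ εs εz tpd (tpp - αs - αz) (c - αs - αz) Ts Tz x y ε =
      (εs - ε) * (εz - ε) * W4 Δ tpd tpp c (αs / (εs - ε) + αz / (εz - ε)) x y ε := by
  rw [dsec5_fixedFS Δ εs εz tpd tpp c αs αz Ts Tz x y ε hTs hTz hP, W4]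
  field_simp

/-! ## §3 Sign structure: shape co-shifts are signed, slopes are positive -/

/-- A level ABOVE the energy (`ε < ε_a`, `T > 0`) co-shifts the O–O couplings UP: `α = T/(ε_a − ε) > 0` (more curved Fermi surface, by
`fsRatio_coshift_anti`). [cite: PavariniEtAl2001, Fig. 3] -/
theorem admixture_pos_of_above {T εa ε : ℝ} (hT : 0 < T) (h : ε < εa) : 0 < T / (εa - ε) :=
  div_pos hT (sub_pos.mpr h)

/-- A level BELOW the energy (`ε_a < ε`, `T > 0`) co-shifts the O–O couplings DOWN: `α = T/(ε_a − ε) < 0` (flatter Fermi surface).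
[cite: PavariniEtAl2001, text (the 3d_{3z²−1} component of the axial hybrid)] -/
theorem admixture_neg_of_below {T εa ε : ℝ} (hT : 0 < T) (h : εa < ε) : T / (εa - ε) < 0 :=
  div_neg_of_pos_of_neg hT (sub_neg.mpr h)

/-- The admixture SLOPE is positive on EITHER side: `a′ = T/(ε_a − ε)² > 0` (`T > 0`, `ε ≠ ε_a`). [folklore] -/
theorem slope_pos {T εa ε : ℝ} (hT : 0 < T) (h : εa ≠ ε) : 0 < T / (εa - ε) ^ 2 := by
  have hne : εa - ε ≠ 0 := sub_ne_zero.mpr h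
  positivity

/-- Slope and admixture of one channel: `a′ = α/(ε_a − ε)` with `α = T/(ε_a − ε)`. [folklore] -/
theorem slope_eq_admixture_div {T εa ε : ℝ} (h : εa - ε ≠ 0) : T / (εa - ε) ^ 2 = (T / (εa - ε)) / (εa - ε) := by
  field_simp

/-- **SHAPE-CANCELLING, SLOPE-ADDING PAIR.** Two channels with admixtures `α_s = T_s/(ε_s − ε)` (above: `ε < ε_s`) and
`α_z = T_z/(ε_z − ε)` (below: `ε_z < ε`) that CANCEL in the Fermi-surface shape (`α_s + α_z = 0`) have total slope
`a′_s + a′_z = α_s·(1/(ε_s − ε) + 1/(ε − ε_z))` — strictly positive when `α_s > 0`: the Fermi surface stays that of the frozen σ set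
while the antinodal form defect grows. [folklore] -/
theorem shape_cancel_slope_add {αs αz εs εz ε : ℝ} (hs : ε < εs) (hz : εz < ε) (hsum : αs + αz = 0) (hαs : 0 < αs) :
    αs / (εs - ε) + αz / (εz - ε) = αs * (1 / (εs - ε) + 1 / (ε - εz)) ∧ 0 < αs / (εs - ε) + αz / (εz - ε) := by
  have hz' : αz = -αs := by linarith
  have h1 : εs - ε ≠ 0 := (sub_pos.mpr hs).ne'
  have h2 : εz - ε ≠ 0 := (sub_neg.mpr hz).ne
  have h3 : ε - εz ≠ 0 := (sub_pos.mpr hz).ne'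
  have key : αs / (εs - ε) + αz / (εz - ε) = αs * (1 / (εs - ε) + 1 / (ε - εz)) := by
    rw [hz']; field_simp; ring
  refine ⟨key, ?_⟩
  rw [key]
  have : 0 < 1 / (εs - ε) + 1 / (ε - εz) := by
    have a := one_div_pos.mpr (sub_pos.mpr hs)
    have b := one_div_pos.mpr (sub_pos.mpr hz)
    linarith
  positivity

/-- TRADE-OFF of one channel: a slope `A` delivered from distance `d = ε_a − ε_F` needs coupling `T = A·d²` and produces admixture
`α = A·d` (so a NEAR level delivers slope cheaply in shape, a REMOTE one expensively). [folklore] -/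
theorem channel_tradeoff {A d : ℝ} (hd : d ≠ 0) : A * d ^ 2 / d ^ 2 = A ∧ A * d ^ 2 / d = A * d := by
  constructor
  · field_simp
  · field_simp

end Summit.Ventures.CertifiedManyBodySolver.Downfold.Emery
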